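import Summits.QuantumFields.YangMills.Theorems.FluctuationComparisonRegPrIntLS2BetaNeumannFRDPieces

/-!
# Neumann finite-range decomposition of a uniformly gapped finite-range symmetric matrix:
# the series `M⁻¹ = ∑_t B⁻¹ (1 - M/B)^t` and the sketch's two `Prop`s by text (NFRD-B)

Helper file for crux `Summit.QuantumFields.YangMills.Theses.UnitScaleTilt.FluctuationComparisonRegPrIntL`
(item stmt-QuantumFields-20520), `--supports`, hypothesis form, **definition-free**.  Second of two
files (first: `…S2BetaNeumannFRDPieces` = range, entrywise locality, positivity and geometric decay of
the pieces) proving the ideator's (ym-r3-idea-1 g19) first lemma of crux idea `neumann-frd-step`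
(`Cruxes/FluctuationComparisonRegPrIntL/NeumannFRDSketch.lean`; card `Ideas/neumann-frd-step.md`;
LOCATE-GAS1-REP §2c — the FINITE-RANGE route for GAS₁ of LINE g19-2 `Lines/loop_ledger.lean`).

* §4 NEUMANN SERIES: a coercive matrix is invertible (`isUnit_det_of_coercive`); the EXACT finite
  decomposition with remainder `M⁻¹ = ∑_{i<n} B⁻¹ • X^i + X^n * M⁻¹`, `X := 1 - B⁻¹ • M`
  (`inv_eq_sum_add_pow_mul_inv`, pure algebra — `geom_sum_mul_neg`); `X^n → 0` entrywise
  (`tendsto_neumannPiece`); and `HasSum (fun t => B⁻¹ • X^t) M⁻¹` (`hasSum_neumann`, entrywise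
  geometric domination + `Pi.hasSum`).
* §5 THE SKETCH'S PROPS BY TEXT: `neumannFRD` = `NeumannFRD` UNFOLDED TOKEN FOR TOKEN and
  `neumannFRDFamilyLocal` = `NeumannFRDFamilyLocal` unfolded, so a line importing this file closes
  them by `:= neumannFRD` / `:= neumannFRDFamilyLocal`.

Sources: [cite: Bauerschmidt2013, arXiv:1206.2212, §1 and Thm 1.2 (Neumann case)],
[cite: BrydgesGuadagniMitter2004, arXiv:math-ph/0303013, §1–2]; re-routed step
[cite: Balaban1985UV3, §A (25)–(37)].

HONEST LABEL.  Linear algebra over `Matrix ι ι ℝ` supplying NO estimate of the lane: not GAS₁, not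
REP, not E′, not (OPL); nothing of `FluctuationComparisonRegPrIntL` (20520) is proved here.  Rung R3
(YM₃ = SU(2) on T³) is NOT d = 4, NOT infinite volume, NOT a mass gap, NOT the Clay problem.
-/

namespace Summit.QuantumFields.YangMills.Theorems.FluctuationComparisonRegPrIntLS2BetaNeumannFRD

open Matrix Finset Filter Topology
open Summit.QuantumFields.YangMills.Theorems.FluctuationComparisonRegPrIntLS2BetaNeumannFRDPieces

variable {ι : Type*} [Fintype ι] [DecidableEq ι]

/-! ## §4 The Neumann series -/

/-- A coercive matrix (`m (z ⬝ᵥ z) ≤ z ⬝ᵥ M *ᵥ z`, `0 < m`) has invertible determinant. -/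
theorem isUnit_det_of_coercive (M : Matrix ι ι ℝ) {m : ℝ} (hm : 0 < m)
    (hlo : ∀ z : ι → ℝ, m * (z ⬝ᵥ z) ≤ z ⬝ᵥ M *ᵥ z) : IsUnit M.det := by
  rw [← Matrix.isUnit_iff_isUnit_det, ← Matrix.mulVec_injective_iff_isUnit]
  intro x y hxy
  have h0 : M *ᵥ (x - y) = 0 := by
    rw [Matrix.mulVec_sub]
    exact sub_eq_zero.mpr hxy
  have h1 := hlo (x - y)
  rw [h0, dotProduct_zero] at h1
  have h2 : (x - y) ⬝ᵥ (x - y) ≤ 0 := by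
    by_contra h
    have h' : 0 < (x - y) ⬝ᵥ (x - y) := lt_of_not_ge h
    linarith [mul_pos hm h']
  have h3 : (x - y) ⬝ᵥ (x - y) = 0 :=
    le_antisymm h2 (Finset.sum_nonneg fun i _ => mul_self_nonneg ((x - y) i))
  exact sub_eq_zero.mp (dotProduct_self_eq_zero.mp h3)

/-- FINITE NEUMANN DECOMPOSITION WITH REMAINDER: for `M` with `IsUnit M.det`, every `B` and `n`,
`M⁻¹ = (∑ i ∈ range n, B⁻¹ • (1 - B⁻¹ • M) ^ i) + (1 - B⁻¹ • M) ^ n * M⁻¹` (pure algebra: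
`geom_sum_mul_neg`; for `B = 0` both sides are `M⁻¹`). -/
theorem inv_eq_sum_add_pow_mul_inv (M : Matrix ι ι ℝ) (hM : IsUnit M.det) (B : ℝ) (n : ℕ) :
    M⁻¹ = (∑ i ∈ Finset.range n, B⁻¹ • (1 - B⁻¹ • M) ^ i) + (1 - B⁻¹ • M) ^ n * M⁻¹ := by
  set X : Matrix ι ι ℝ := 1 - B⁻¹ • M with hXdef
  have hgeom := geom_sum_mul_neg X n
  have h1X : (1 : Matrix ι ι ℝ) - X = B⁻¹ • M := by
    rw [hXdef, sub_sub_cancel]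
  rw [h1X] at hgeom
  have hsum : (∑ i ∈ Finset.range n, B⁻¹ • X ^ i) = (1 - X ^ n) * M⁻¹ := by
    rw [← hgeom, Matrix.mul_smul, Matrix.smul_mul, mul_assoc, Matrix.mul_nonsing_inv M hM,
      mul_one, Finset.smul_sum]
  rw [hsum, sub_mul, one_mul, sub_add_cancel]

/-- The Neumann pieces tend to zero: `(1 - B⁻¹ • M) ^ n → 0` in `Matrix ι ι ℝ` (entrywise), for
`M` symmetric with `m‖z‖² ≤ zᵀMz ≤ B‖z‖²`, `0 < m ≤ B`. -/
theorem tendsto_neumannPiece (M : Matrix ι ι ℝ) (hM : M.IsSymm) {m B : ℝ} (hm : 0 < m)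
    (hmB : m ≤ B) (hlo : ∀ z : ι → ℝ, m * (z ⬝ᵥ z) ≤ z ⬝ᵥ M *ᵥ z)
    (hhi : ∀ z : ι → ℝ, z ⬝ᵥ M *ᵥ z ≤ B * (z ⬝ᵥ z)) :
    Tendsto (fun n : ℕ => (1 - B⁻¹ • M) ^ n) atTop (𝓝 0) := by
  have hB : 0 < B := lt_of_lt_of_le hm hmB
  have hlam0 : 0 ≤ 1 - m / B := by
    rw [sub_nonneg, div_le_one hB]; exact hmB
  have hlam1 : 1 - m / B < 1 := by
    have : 0 < m / B := div_pos hm hB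
    linarith
  have habs := (neumannPiece_bounds M hM hm hmB hlo hhi).2
  refine tendsto_pi_nhds.2 fun a => tendsto_pi_nhds.2 fun c => ?_
  show Tendsto (fun n : ℕ => ((1 - B⁻¹ • M) ^ n) a c) atTop (𝓝 (0 : ℝ))
  refine squeeze_zero_norm (fun n => ?_) (tendsto_pow_atTop_nhds_zero_of_lt_one hlam0 hlam1)
  rw [Real.norm_eq_abs]
  exact habs n a c

/-- Partial sums of the Neumann series converge to `M⁻¹` (matrix form). -/
theorem tendsto_sum_neumannPiece (M : Matrix ι ι ℝ) (hM : M.IsSymm) {m B : ℝ} (hm : 0 < m)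
    (hmB : m ≤ B) (hlo : ∀ z : ι → ℝ, m * (z ⬝ᵥ z) ≤ z ⬝ᵥ M *ᵥ z)
    (hhi : ∀ z : ι → ℝ, z ⬝ᵥ M *ᵥ z ≤ B * (z ⬝ᵥ z)) :
    Tendsto (fun n : ℕ => ∑ i ∈ Finset.range n, B⁻¹ • (1 - B⁻¹ • M) ^ i) atTop (𝓝 M⁻¹) := by
  have hdet := isUnit_det_of_coercive M hm hlo
  have heq : (fun n : ℕ => ∑ i ∈ Finset.range n, B⁻¹ • (1 - B⁻¹ • M) ^ i) =
      fun n : ℕ => M⁻¹ - (1 - B⁻¹ • M) ^ n * M⁻¹ := by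
    funext n
    rw [eq_sub_iff_add_eq]
    exact (inv_eq_sum_add_pow_mul_inv M hdet B n).symm
  rw [heq]
  have hpow := tendsto_neumannPiece M hM hm hmB hlo hhi
  have hmul : Tendsto (fun n : ℕ => (1 - B⁻¹ • M) ^ n * M⁻¹) atTop (𝓝 (0 * M⁻¹)) :=
    ((continuous_id.matrix_mul continuous_const).tendsto 0).comp hpow
  rw [zero_mul] at hmul
  simpa using tendsto_const_nhds.sub hmul

/-- §4 NEUMANN SERIES: for `M` real symmetric with `m‖z‖² ≤ zᵀMz ≤ B‖z‖²` (`0 < m ≤ B`),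
`HasSum (fun t => B⁻¹ • (1 - B⁻¹ • M) ^ t) M⁻¹`. -/
theorem hasSum_neumann (M : Matrix ι ι ℝ) (hM : M.IsSymm) {m B : ℝ} (hm : 0 < m) (hmB : m ≤ B)
    (hlo : ∀ z : ι → ℝ, m * (z ⬝ᵥ z) ≤ z ⬝ᵥ M *ᵥ z)
    (hhi : ∀ z : ι → ℝ, z ⬝ᵥ M *ᵥ z ≤ B * (z ⬝ᵥ z)) :
    HasSum (fun t : ℕ => B⁻¹ • (1 - B⁻¹ • M) ^ t) M⁻¹ := by
  have hB : 0 < B := lt_of_lt_of_le hm hmB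
  have hlam0 : 0 ≤ 1 - m / B := by
    rw [sub_nonneg, div_le_one hB]; exact hmB
  have hlam1 : 1 - m / B < 1 := by
    have : 0 < m / B := div_pos hm hB
    linarith
  have habs := (neumannPiece_bounds M hM hm hmB hlo hhi).2
  have hpartial := tendsto_sum_neumannPiece M hM hm hmB hlo hhi
  refine Pi.hasSum.2 fun a => Pi.hasSum.2 fun c => ?_
  have hsumm : Summable (fun t : ℕ => (B⁻¹ • (1 - B⁻¹ • M) ^ t) a c) := by
    refine Summable.of_norm_bounded ((summable_geometric_of_lt_one hlam0 hlam1).mul_left |B⁻¹|)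
      fun t => ?_
    rw [Real.norm_eq_abs, Matrix.smul_apply, smul_eq_mul, abs_mul]
    exact mul_le_mul_of_nonneg_left (habs t a c) (abs_nonneg _)
  refine (hsumm.hasSum_iff_tendsto_nat).2 ?_
  have h1 := (tendsto_pi_nhds.1 ((tendsto_pi_nhds.1 hpartial) a)) c
  refine h1.congr fun n => ?_
  simp [Matrix.sum_apply]

/-! ## §5 The sketch's two `Prop`s, by text -/

/-- **`NeumannFRD` of `Cruxes/FluctuationComparisonRegPrIntL/NeumannFRDSketch.lean`, UNFOLDED TOKEN
FOR TOKEN** — NEUMANN FINITE-RANGE DECOMPOSITION WITH ENTRYWISE LOCALITY: for a real symmetric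
matrix `M` on a finite index set with a pseudo-metric `dist`, of range `r` (`M a c = 0` when
`dist a c > r`) and spectrum in `[m, B]` (`0 < m ≤ B`, as quadratic-form bounds): the pieces
`(1 − M/B)^t` have range `≤ r t`, are positive semi-definite with form `≤ (1 − m/B)^t ‖x‖²`,
`∑_t B⁻¹ (1 − M/B)^t = M⁻¹`, and the entry `((1 − M/B)^t) a c` depends only on the entries `M x y`
with `dist a x ≤ r t`, `dist a y ≤ r t`.  A line importing this file closes the sketch's `NeumannFRD`
by `:= neumannFRD`.  (The symmetry hypothesis on `dist` is carried, unused.)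
[cite: Bauerschmidt2013, §1 and Thm 1.2 (Neumann case)] [cite: BrydgesGuadagniMitter2004, §1–2] -/
theorem neumannFRD :
    ∀ (ι : Type) [Fintype ι] [DecidableEq ι] (dist : ι → ι → ℕ) (r : ℕ) (m B : ℝ) (M : Matrix ι ι ℝ),
    0 < m → m ≤ B → M.IsSymm →
    (∀ a, dist a a = 0) → (∀ a c, dist a c = dist c a) → (∀ a b c, dist a c ≤ dist a b + dist b c) →
    (∀ a c, r < dist a c → M a c = 0) →
    (∀ x : ι → ℝ, m * (∑ a, x a ^ 2) ≤ ∑ a, ∑ c, x a * M a c * x c) →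
    (∀ x : ι → ℝ, ∑ a, ∑ c, x a * M a c * x c ≤ B * (∑ a, x a ^ 2)) →
      (∀ (t : ℕ) (a c : ι), r * t < dist a c → ((1 - B⁻¹ • M) ^ t) a c = 0) ∧
      (∀ (t : ℕ) (x : ι → ℝ), 0 ≤ ∑ a, ∑ c, x a * ((1 - B⁻¹ • M) ^ t) a c * x c) ∧
      (∀ (t : ℕ) (x : ι → ℝ), ∑ a, ∑ c, x a * ((1 - B⁻¹ • M) ^ t) a c * x c ≤ (1 - m / B) ^ t * ∑ a, x a ^ 2) ∧
      HasSum (fun t : ℕ => B⁻¹ • (1 - B⁻¹ • M) ^ t) M⁻¹ ∧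
      (∀ (t : ℕ) (a c : ι) (M' : Matrix ι ι ℝ), (∀ x y, dist a x ≤ r * t → dist a y ≤ r * t → M x y = M' x y) →
        (∀ x y, r < dist x y → M' x y = 0) → ((1 - B⁻¹ • M) ^ t) a c = ((1 - B⁻¹ • M') ^ t) a c) := by
  intro ι _ _ dist r m B M hm hmB hM hd0 _hsymm htri hrange hlo hhi
  have hlo' : ∀ z : ι → ℝ, m * (z ⬝ᵥ z) ≤ z ⬝ᵥ M *ᵥ z := by
    intro z
    rw [← sum_sq_eq_dotProduct, ← sum_sum_mul_eq_dotProduct_mulVec]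
    exact hlo z
  have hhi' : ∀ z : ι → ℝ, z ⬝ᵥ M *ᵥ z ≤ B * (z ⬝ᵥ z) := by
    intro z
    rw [← sum_sq_eq_dotProduct, ← sum_sum_mul_eq_dotProduct_mulVec]
    exact hhi z
  have hpow := (neumannPiece_bounds M hM hm hmB hlo' hhi').1
  refine ⟨neumannPiece_apply_eq_zero_of_lt_dist dist hd0 htri M r B hrange, ?_, ?_,
    hasSum_neumann M hM hm hmB hlo' hhi', ?_⟩
  · intro t x
    rw [sum_sum_mul_eq_dotProduct_mulVec]
    exact (hpow t x).1
  · intro t x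
    rw [sum_sum_mul_eq_dotProduct_mulVec, sum_sq_eq_dotProduct]
    exact (hpow t x).2
  · intro t a c M' hagree hrange'
    exact neumannPiece_apply_eq_of_agree dist hd0 htri r B M M' hrange hrange' t a c hagree

/-- **`NeumannFRDFamilyLocal` of the sketch, UNFOLDED TOKEN FOR TOKEN** (the FAMILY form the step
uses): a `U`-indexed family of range-`r` matrices whose entries near `a` depend on `U` near `a`
yields Neumann pieces whose entries at `a` depend on `U` within `r t` of `a`, for an abstract parameter
space with «agreement» sets.  Closable by `:= neumannFRDFamilyLocal`.  (Needs no spectral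
hypothesis and no symmetry of `dist`; those binders are carried unused.) -/
theorem neumannFRDFamilyLocal :
    ∀ (ι P : Type) [Fintype ι] [DecidableEq ι] (dist : ι → ι → ℕ) (r : ℕ) (B : ℝ)
    (agree : ι → ℕ → P → P → Prop)
    (M : P → Matrix ι ι ℝ),
    (∀ a n U U', agree a n U U' → ∀ x y, dist a x ≤ n → dist a y ≤ n → M U x y = M U' x y) →
    (∀ U x y, r < dist x y → M U x y = 0) →
    (∀ a, dist a a = 0) → (∀ a c, dist a c = dist c a) → (∀ a b c, dist a c ≤ dist a b + dist b c) →
    ∀ (t : ℕ) (a c : ι) (U U' : P), agree a (r * t) U U' →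
      ((1 - B⁻¹ • M U) ^ t) a c = ((1 - B⁻¹ • M U') ^ t) a c := by
  intro ι P _ _ dist r B agree M hagree hrange hd0 _hsymm htri t a c U U' hUU'
  exact neumannPiece_apply_eq_of_agree dist hd0 htri r B (M U) (M U') (hrange U) (hrange U') t a c
    (hagree a (r * t) U U' hUU')

end Summit.QuantumFields.YangMills.Theorems.FluctuationComparisonRegPrIntLS2BetaNeumannFRD
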